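import Literature.NumberTheory.EllipticCurves.KubertTateFiveEisensteinTwistMinimalModel
import Literature.NumberTheory.EllipticCurves.KubertTate277ShaFive
import Literature.NumberTheory.EllipticCurves.LocalReductionKrausMinimality
import Literature.NumberTheory.EllipticCurves.ComplexMultiplicationLocalFactorsAux
import Literature.NumberTheory.EllipticCurves.RationalPointInfiniteOrderCriteria
import Mathlib.Tactic.NormNum.Prime
import HarnessLib

/-!
# The Eisenstein twist `E_{27/7}^{(-3)}`: RANK `1`, `t₅ = 0` unconditionally, on its minimal model `[0, 261, −11, 118014, −12051831]` —
# the second rank-`1` row, read through the CLASS-WIDE theorem `cgls_hypotheses_of_model` (`corank_{ℤ₅} Sel_{5^∞} = 1`, `a₅ = -1`)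

PROOF-ONLY file (theorems only, no definition, no named fact, no `sorry`), topic `NumberTheory/EllipticCurves`; a second rank-`1` instance of
the Eisenstein-twist door, and the first obtained from the class-wide packaging `KubertTateFiveEisensteinTwistMinimalModel.cgls_hypotheses_of_model`
(good / reducible / non-anomalous at `5` and the Selmer corank for ANY globally minimal model of `E_{m,n}^{(-3)}`), so that the per-curve input is
only: the full `ℚ`-box of `E_{27/7}` (tree `KubertTate277Descent`: rank `1`, points `(0,1323)`, `(35,98)`), Eisenstein tameness
(`Δ = -3¹⁵·7⁵·1399`, `1399 ≡ 4 (mod 5)`, `≡ 1 (mod 3)`), a globally minimal model of the twist, and ONE point of infinite order on it.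

* `W = [0, 261, −11, 118014, −12051831]`, `⟨1, 2, 0, 11/2⟩ • W = E_{27/7}^{(-3)} = [0, 267, 0, 119070, −47258883/4]`; `W` is globally minimal
  (`Δ_W = -3²¹·7⁵·1399`, `3⁴ ∤ c₄ = -4574736`, no other `q¹² ∣ Δ`); rational points `P = (21701/4, 3279005/8)` (twist point `u = -7231/4`) and
  `2P = (55464979989169/43342243344, 465609887249605201007/9023334957300672)` with `3 ∣ den x(2P)` ⟹ `rank W(ℚ) ≥ 1 = ω₂(189)`.
* `twist_27_7` — **`rank E_{27/7}^{(-3)}(ℚ) = 1`, `t₅(E_{27/7}^{(-3)}) = 0`, `t₅(E_{27/7}) = 0`**;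
* `cgls_hypotheses_27_7` — **`Good W 5 ∧ Red W 5 ∧ ¬ Anom W 5 ∧ corank_{ℤ₅} Sel_{5^∞}(W/ℚ) = 1 ∧ rank W(ℚ) = 1`**, by the class-wide theorem
  (`a₅(W) = -a₅(E_{27/7}) = -1`: twisting formula, `5` inert in `ℚ(√-3)`).

Transfer statement T (stmt-BirchSwinnertonDyer-22356) instrument: with CGLS Thm. E (`r = 1`) + GZK the Summits reading discharges T at `W`.
BSD is not proved by this.

## References

* [SilvermanAEC2009] J. H. Silverman, *AEC*, 2nd ed., III.1 Table 3.1, VII.1 Remark 1.1, VII.3.4, VIII.6.7, X.§2, Exercise 10.16.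
* [Fisher2001FiveSevenDescent] T. Fisher, JEMS 3 (2001), §§1–2.
* [CastellaGrossiLeeSkinner2022] F. Castella, G. Grossi, J. Lee, C. Skinner, Invent. Math. 227 (2022), Thm. E.
* [Kraus1989] A. Kraus, *Quelques remarques à propos des invariants c₄, c₆ et Δ d'une courbe elliptique*, Prop. 2.
-/

noncomputable section

open scoped Classical
open WeierstrassCurve Literature.NumberTheory.EllipticCurves
open Literature.NumberTheory.EllipticCurves.Rank1Residual.X11RankOneCertificates (discOf c4Of c6Of)
open Literature.NumberTheory.EllipticCurves.Rank1Residual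

namespace Literature.NumberTheory.EllipticCurves

namespace KubertTate277EisensteinTwist

/-! ## §1 The base curve `E_{27/7}`: Eisenstein tameness, coprimality, `ω = 2`, `ω₂ = 1` -/

/-- **Eisenstein tameness of `E_{27/7}`**: bad primes `3, 7, 1399 ≡ 3, 2, 4 (mod 5)`; `1399 ≡ 1 (mod 3)` (split in `ℤ[ζ₃]`).
[cite: Fisher2001FiveSevenDescent, §2] -/
theorem eisenstein_tame : ∀ ℓ : ℕ, ℓ.Prime → (ℓ : ℤ) ∣ (kubertTateFive (27 : ℤ) 7).Δ →
    ℓ % 5 ≠ 1 ∧ (ℓ % 5 = 4 → ℓ % 3 = 1) := by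
  intro p hp hdvd
  refine ⟨KubertTate277Descent.tame p hp hdvd, fun h4 ↦ ?_⟩
  rw [KubertTate277Descent.Δ_int] at hdvd
  have hdvdN : p ∣ 3 ^ 15 * 7 ^ 5 * 1399 := by
    have h' : (p : ℤ) ∣ ((3 ^ 15 * 7 ^ 5 * 1399 : ℕ) : ℤ) := by
      have e : ((3 ^ 15 * 7 ^ 5 * 1399 : ℕ) : ℤ) = 337385749848651 := by norm_num
      rw [e]; exact (Int.dvd_neg.mpr hdvd)
    exact Int.natCast_dvd_natCast.mp h'
  have hpi := Nat.Prime.prime hp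
  rcases hpi.dvd_or_dvd hdvdN with h | h
  · rcases hpi.dvd_or_dvd h with h | h
    · have := (Nat.prime_dvd_prime_iff_eq hp Nat.prime_three).mp (hpi.dvd_of_dvd_pow h); omega
    · have := (Nat.prime_dvd_prime_iff_eq hp (by norm_num : Nat.Prime 7)).mp (hpi.dvd_of_dvd_pow h); omega
  · have := (Nat.prime_dvd_prime_iff_eq hp (by norm_num : Nat.Prime 1399)).mp h; omega

/-- `27` and `7` are coprime. [folklore] -/
private theorem isCoprime : IsCoprime (27 : ℤ) 7 := Int.isCoprime_iff_gcd_eq_one.mpr (by norm_num)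

/-- `ω(189) = 2` and `ω₂(189) = 1` (`189 = 3³·7`, `7 ≡ 1 (mod 3)`). [folklore] -/
private theorem card_primeFactors :
    (((27 : ℤ) * 7).natAbs.primeFactors).card = 2 ∧ ((((27 : ℤ) * 7).natAbs.primeFactors.filter (fun ℓ ↦ ℓ % 3 = 1))).card = 1 := by
  have e : ((27 : ℤ) * 7).natAbs = 3 ^ 3 * 7 := by norm_num
  rw [e, Nat.primeFactors_mul (by norm_num) (by norm_num), Nat.primeFactors_prime_pow (by norm_num) Nat.prime_three,
    Nat.Prime.primeFactors (by norm_num : Nat.Prime 7)]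
  exact ⟨by decide, by decide⟩

/-- The twist by `-3` is elliptic. [cite: SilvermanAEC2009, X.§2] -/
theorem isElliptic_twist :
    haveI := KubertTate277Descent.isElliptic
    ((kubertTateFive (((27 : ℤ) : ℚ)) (((7 : ℤ) : ℚ))).quadraticTwist (-3)).IsElliptic := by
  haveI := KubertTate277Descent.isElliptic
  exact isElliptic_quadraticTwist _ (by norm_num)

/-! ## §2 The minimal model `W = [0, 261, −11, 118014, −12051831]` and its points -/

/-- **`E_{27/7}^{(-3)} = [0, 267, 0, 119070, −47258883/4]`** (`b₂ = -356`, `b₄ = 26460`, `b₆ = 1750329`). [cite: SilvermanAEC2009, X.§2] -/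
theorem twist_eq : (kubertTateFive (((27 : ℤ) : ℚ)) (((7 : ℤ) : ℚ))).quadraticTwist (-3) =
    (⟨0, 267, 0, 119070, -47258883 / 4⟩ : WeierstrassCurve ℚ) := by
  rw [KubertTate277Descent.curve_eq]
  ext <;> simp [quadraticTwist, WeierstrassCurve.b₂, WeierstrassCurve.b₄, WeierstrassCurve.b₆] <;> norm_num

/-- **`⟨1, 2, 0, 11/2⟩ • W = E_{27/7}^{(-3)}`** for the integer model `W = [0, 261, −11, 118014, −12051831]`. [cite: SilvermanAEC2009, III.1 Table 3.1] -/
theorem variableChange_model :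
    (⟨1, 2, 0, 11 / 2⟩ : VariableChange ℚ) •
        (⟨((0 : ℤ) : ℚ), ((261 : ℤ) : ℚ), ((-11 : ℤ) : ℚ), ((118014 : ℤ) : ℚ), ((-12051831 : ℤ) : ℚ)⟩ : WeierstrassCurve ℚ) =
      (kubertTateFive (((27 : ℤ) : ℚ)) (((7 : ℤ) : ℚ))).quadraticTwist (-3) := by
  rw [twist_eq]
  ext <;> simp [variableChange_a₁, variableChange_a₂, variableChange_a₃, variableChange_a₄, variableChange_a₆] <;> norm_num

/-- The model `W` is elliptic. [cite: SilvermanAEC2009, X.§2] -/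
theorem isElliptic_model :
    (⟨((0 : ℤ) : ℚ), ((261 : ℤ) : ℚ), ((-11 : ℤ) : ℚ), ((118014 : ℤ) : ℚ), ((-12051831 : ℤ) : ℚ)⟩ : WeierstrassCurve ℚ).IsElliptic := by
  refine ⟨isUnit_iff_ne_zero.mpr ?_⟩
  norm_num [WeierstrassCurve.Δ, WeierstrassCurve.b₂, WeierstrassCurve.b₄, WeierstrassCurve.b₆, WeierstrassCurve.b₈]

/-- `Δ`, `c₄` of the integer model (kernel evaluation). [folklore] -/
private theorem invariants_model :
    discOf [0, 261, -11, 118014, -12051831] = -245954211639666579 ∧ c4Of [0, 261, -11, 118014, -12051831] = -4574736 := by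
  refine ⟨?_, ?_⟩ <;> decide

/-- **`W` is globally minimal**: `Δ_W = -3²¹·7⁵·1399`; at `3`, `3⁴ ∤ c₄ = -4574736 = -2⁴·3²·31769`; no other `q¹² ∣ Δ`.
[cite: SilvermanAEC2009, VII.1 Remark 1.1] [cite: Kraus1989, Prop. 2] -/
theorem isGloballyMinimal_model :
    (⟨((0 : ℤ) : ℚ), ((261 : ℤ) : ℚ), ((-11 : ℤ) : ℚ), ((118014 : ℤ) : ℚ), ((-12051831 : ℤ) : ℚ)⟩ :
      WeierstrassCurve ℚ).IsGloballyMinimal := by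
  obtain ⟨hD, hc4⟩ := invariants_model
  refine WeierstrassCurve.isGloballyMinimal_of_int_kraus 0 261 (-11) 118014 (-12051831) fun q hq ↦ Or.inl fun h ↦ ?_
  obtain ⟨h12, h4⟩ := h
  rw [hD] at h12
  rw [hc4] at h4
  have hq1 : (q : ℤ) ∣ 245954211639666579 := Int.dvd_neg.mp (dvd_trans (dvd_pow_self _ (by norm_num)) h12)
  have hdvdN : q ∣ 3 ^ 21 * 7 ^ 5 * 1399 := by
    have e : ((3 ^ 21 * 7 ^ 5 * 1399 : ℕ) : ℤ) = 245954211639666579 := by norm_num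
    exact Int.natCast_dvd_natCast.mp (e ▸ hq1)
  have hpi := Nat.Prime.prime hq
  rcases hpi.dvd_or_dvd hdvdN with h | h
  · rcases hpi.dvd_or_dvd h with h | h
    · have := (Nat.prime_dvd_prime_iff_eq hq Nat.prime_three).mp (hpi.dvd_of_dvd_pow h)
      subst this; revert h4; norm_num
    · have := (Nat.prime_dvd_prime_iff_eq hq (by norm_num : Nat.Prime 7)).mp (hpi.dvd_of_dvd_pow h)
      subst this; revert h12; norm_num
  · have := (Nat.prime_dvd_prime_iff_eq hq (by norm_num : Nat.Prime 1399)).mp h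
    subst this; revert h12; norm_num

/-- **The rational point `2P = (55464979989169/43342243344, 465609887249605201007/9023334957300672)` of `W`** (`P = (21701/4, 3279005/8)` from the twist
point `u = -7231/4` of `E_{27/7}`; `den x(2P) = 2⁴·3⁴·5783²`). [cite: SilvermanAEC2009, III.2.3] -/
theorem nonsingular_twoP :
    (⟨((0 : ℤ) : ℚ), ((261 : ℤ) : ℚ), ((-11 : ℤ) : ℚ), ((118014 : ℤ) : ℚ), ((-12051831 : ℤ) : ℚ)⟩ : WeierstrassCurve ℚ).toAffine.Nonsingular
      (55464979989169 / 43342243344) (465609887249605201007 / 9023334957300672) := by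
  haveI := isElliptic_model
  rw [← Affine.equation_iff_nonsingular, Affine.equation_iff]
  push_cast
  norm_num

/-- **`rank W(ℚ) ≥ 1`**: `3 ∣ den x(2P)` (Lutz–Nagell at the odd prime `3` on the globally minimal model; tree
`one_le_mordellWeilRank_of_dvd_den`). [cite: SilvermanAEC2009, VII.3.4 and Thm. VIII.6.7] -/
theorem one_le_mordellWeilRank_model :
    haveI := isElliptic_model
    1 ≤ (⟨((0 : ℤ) : ℚ), ((261 : ℤ) : ℚ), ((-11 : ℤ) : ℚ), ((118014 : ℤ) : ℚ), ((-12051831 : ℤ) : ℚ)⟩ : WeierstrassCurve ℚ).mordellWeilRank := by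
  haveI := isElliptic_model
  haveI := isGloballyMinimal_model
  haveI : Fact (Nat.Prime 3) := ⟨Nat.prime_three⟩
  exact one_le_mordellWeilRank_of_dvd_den _ 3 le_rfl nonsingular_twoP (by norm_num)

/-! ## §3 Rank `1`, `t₅ = 0`, and the CGLS hypotheses — by the class-wide theorems -/

/-- **`rank E_{27/7}^{(-3)}(ℚ) = 1`, `t₅(E_{27/7}^{(-3)}/ℚ) = 0`, `t₅(E_{27/7}/ℚ) = 0` — unconditionally** (class-wide
`KubertTateEisensteinTwist.twist_door_of_le_rank_three`; full `ℚ`-box `rank E = 1 = ω − 1`, twist rank `≥ 1 = ω₂`; reference point `(35, 98)`, good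
prime `11`). [cite: SilvermanAEC2009, Thm. X.4.2 and Exercise 10.16] [cite: Fisher2001FiveSevenDescent, §2] -/
theorem twist_27_7 :
    haveI := isElliptic_twist
    ((kubertTateFive (((27 : ℤ) : ℚ)) (((7 : ℤ) : ℚ))).quadraticTwist (-3)).mordellWeilRank = 1 ∧
      ((kubertTateFive (((27 : ℤ) : ℚ)) (((7 : ℤ) : ℚ))).quadraticTwist (-3)).shaCorank 5 = 0 ∧
      (kubertTateFive (((27 : ℤ) : ℚ)) (((7 : ℤ) : ℚ))).shaCorank 5 = 0 := by
  haveI := KubertTate277Descent.isElliptic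
  haveI := isElliptic_twist
  haveI := isElliptic_model
  haveI : Fact (Nat.Prime 11) := ⟨by norm_num⟩
  have hP : (kubertTateFive (((27 : ℤ) : ℚ)) (((7 : ℤ) : ℚ))).toAffine.Nonsingular 35 98 :=
    (KubertTate277Descent.nonsingular_iff _ _).mpr (by norm_num)
  obtain ⟨hω, hω₂⟩ := card_primeFactors
  have hr : ((27 : ℤ) * 7).natAbs.primeFactors.card ≤ (kubertTateFive (((27 : ℤ) : ℚ)) (((7 : ℤ) : ℚ))).mordellWeilRank + 1 := by
    rw [hω, KubertTate277Descent.mordellWeilRank_eq]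
  have hr' : (((27 : ℤ) * 7).natAbs.primeFactors.filter (fun ℓ ↦ ℓ % 3 = 1)).card ≤
      ((kubertTateFive (((27 : ℤ) : ℚ)) (((7 : ℤ) : ℚ))).quadraticTwist (-3)).mordellWeilRank := by
    rw [hω₂, ← KubertTateEisensteinTwist.mordellWeilRank_of_model 27 7 _ _ variableChange_model]
    exact one_le_mordellWeilRank_model
  obtain ⟨ht, hE, hrk⟩ := KubertTateEisensteinTwist.twist_door_of_le_rank_three 27 7 KubertTate277Descent.not_five_dvd_Δ
    eisenstein_tame hP (by norm_num) (by norm_num) 11 (by norm_num) (by norm_num) KubertTate277Descent.not_tor_dvd_Δ hr hr'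
  exact ⟨by rw [hrk, hω₂], ht, hE⟩

/-- **THE CGLS INPUT AT `W`, from the class-wide theorem**: `Good W 5`, `Red W 5`, `¬ Anom W 5` (`a₅(W) = -a₅(E_{27/7}) = -1`),
**`corank_{ℤ₅} Sel_{5^∞}(W/ℚ) = 1`** and `rank W(ℚ) = 1` (tree `KubertTateEisensteinTwist.cgls_hypotheses_of_model`).
[cite: CastellaGrossiLeeSkinner2022, Thm. E (r = 1)] [cite: SilvermanAEC2009, Exercise 10.16] -/
theorem cgls_hypotheses_27_7 :
    haveI := isGloballyMinimal_model
    haveI := isElliptic_model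
    haveI : Fact (Nat.Prime 5) := ⟨Nat.prime_five⟩
    Good (⟨((0 : ℤ) : ℚ), ((261 : ℤ) : ℚ), ((-11 : ℤ) : ℚ), ((118014 : ℤ) : ℚ), ((-12051831 : ℤ) : ℚ)⟩ : WeierstrassCurve ℚ) 5 ∧
      Red (⟨((0 : ℤ) : ℚ), ((261 : ℤ) : ℚ), ((-11 : ℤ) : ℚ), ((118014 : ℤ) : ℚ), ((-12051831 : ℤ) : ℚ)⟩ : WeierstrassCurve ℚ) 5 ∧
      ¬ Anom (⟨((0 : ℤ) : ℚ), ((261 : ℤ) : ℚ), ((-11 : ℤ) : ℚ), ((118014 : ℤ) : ℚ), ((-12051831 : ℤ) : ℚ)⟩ : WeierstrassCurve ℚ) 5 ∧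
      (⟨((0 : ℤ) : ℚ), ((261 : ℤ) : ℚ), ((-11 : ℤ) : ℚ), ((118014 : ℤ) : ℚ), ((-12051831 : ℤ) : ℚ)⟩ : WeierstrassCurve ℚ).selmerCorank 5 = 1 ∧
      (⟨((0 : ℤ) : ℚ), ((261 : ℤ) : ℚ), ((-11 : ℤ) : ℚ), ((118014 : ℤ) : ℚ), ((-12051831 : ℤ) : ℚ)⟩ : WeierstrassCurve ℚ).mordellWeilRank = 1 := by
  haveI := KubertTate277Descent.isElliptic
  haveI := isElliptic_twist
  haveI := isElliptic_model
  haveI := isGloballyMinimal_model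
  haveI : Fact (Nat.Prime 5) := ⟨Nat.prime_five⟩
  haveI : Fact (Nat.Prime 11) := ⟨by norm_num⟩
  have hP : (kubertTateFive (((27 : ℤ) : ℚ)) (((7 : ℤ) : ℚ))).toAffine.Nonsingular 35 98 :=
    (KubertTate277Descent.nonsingular_iff _ _).mpr (by norm_num)
  obtain ⟨hω, hω₂⟩ := card_primeFactors
  have hr : ((27 : ℤ) * 7).natAbs.primeFactors.card ≤ (kubertTateFive (((27 : ℤ) : ℚ)) (((7 : ℤ) : ℚ))).mordellWeilRank + 1 := by
    rw [hω, KubertTate277Descent.mordellWeilRank_eq]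
  have hr' : (((27 : ℤ) * 7).natAbs.primeFactors.filter (fun ℓ ↦ ℓ % 3 = 1)).card ≤
      ((kubertTateFive (((27 : ℤ) : ℚ)) (((7 : ℤ) : ℚ))).quadraticTwist (-3)).mordellWeilRank := by
    rw [hω₂, ← KubertTateEisensteinTwist.mordellWeilRank_of_model 27 7 _ _ variableChange_model]
    exact one_le_mordellWeilRank_model
  have h := KubertTateEisensteinTwist.cgls_hypotheses_of_model 27 7 isCoprime KubertTate277Descent.not_five_dvd_Δ eisenstein_tame hP
    (by norm_num) (by norm_num) 11 (by norm_num) (by norm_num) KubertTate277Descent.not_tor_dvd_Δ hr hr' _ _ variableChange_model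
  rw [hω₂] at h
  exact h

end KubertTate277EisensteinTwist

end Literature.NumberTheory.EllipticCurves

end
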